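import Literature.NumberTheory.Rogawski1990.LocalTransferUnitExplicitFactor        -- ★ `LocalTransferExplicit` (N6 at a frame, ∃-form), `IsLocalDeltaTransferExists`, `finExplicitCollection` (`Δ‴`)
import Literature.NumberTheory.Automorphic.UnitaryGroupPatchedFamiliesTransport    -- ★ `isLocalDeltaTransferExists_iff_of_eqOn_regular` (`G′`-side patch-safety), `stableOrbitalIntegralRel_congr_of_eqOn`
import Literature.NumberTheory.Rogawski1990.LocalTransferCompactSideJunctionCM     -- ★ `isLocalGRegular_of_isLocalStablyConjH` (`G`-regularity is a stable-class function on `H_v`)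
import HarnessLib

/-!
# N6 for EVERY canonical pair: local `Δ‴_v`-transfer transports from the N6 witness pair to any canonical `(m_H, m_G)` (Rogawski (1990) §4.3 (4.3.1), §4.9 Prop. 4.9.1 (a))

Topic `NumberTheory/Rogawski1990`; THEOREMS ONLY (no definition, no instance, no named fact, no `sorry`).  Cell `pub/hodgecm-mathlib`, crux item
stmt-HodgeConjecture-24833 (`H413`), closer edition «Δ‴-PINS EXPOSED» (LEAD F0P3a-plan (g13) T12-35, LHref-S (g2) BOX LH10 #3 «DAY-X DRESS REHEARSAL»):
the closer's rider `Q_K9S` is proved inside the callback of ★ `F0P3Rung0OfLettersNormalised.rung0Data_of_letters_normalised`, which hands the rider ONLY the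
package's pair `(m_H, m_G)` and its CANONICITY — not the local-transfer clause (G3) `IsLocalDeltaTransferExists L H′ v (Δ‴ v) (m_H v) (m_G v) IsLocSmooth IsLocSmooth`
that the LH10 «(D-b)ᵀ» junction consumes at Day X.  The N6 letter ★ `LocalTransferExplicit L H′ μ νH νG` is ∃-form per place («there are canonical `m_H, m_G` with
a `Δ‴_v`-transfer»).  THIS FILE closes the gap once and for all: **local `Δ‴_v`-transfer for ONE canonical pair gives it for EVERY canonical pair**, because
(i) two canonical families (★ `OrbitalMeasureFamily.IsCanonical`: `m c = dν ∕ dt`, `t` a Haar measure on `Z(γ_c)` with mass one on the compact core) AGREE at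
every `P`-class — Haar measure on the (second countable, locally compact) centraliser `Z(γ_c)` is unique up to a scalar (Mathlib `isMulLeftInvariant_eq_smul`)
and the scalar is read off the common value `1` on the compact core; (ii) (4.3.1) reads `m_G` only at the regular classes (★ `isLocalDeltaTransferExists_iff_of_eqOn_regular`)
and `m_H` only at the classes stably conjugate to a `G`-regular `γ_H`, which are `G`-regular (★ `isLocalGRegular_of_isLocalStablyConjH`; the `H`-side twin
`IsDeltaTransferExistsRel.iff_of_eqOn_left` is proved here).  Print: «the orbital integrals are defined using compatible measures on `H_{γ′}` and `G_γ`» (§4.3 p. 43)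
— Prop. 4.9.1 (a) is a statement about THE compatible (canonical) measures, i.e. about every canonical pair at once; the tree's ∃-form and ∀-form are
equivalent by this file.
Main results: `OrbitalMeasureFamily.IsCanonical.eqOn` (§1, abstract), `IsDeltaTransferRel.iff_of_eqOn_left` ∕
`IsDeltaTransferExistsRel.iff_of_eqOn_left` (§2, abstract), `UnitaryGroup.IsCanonical.eqOn_isRegularElt_G` ∕ `UnitaryGroup.IsCanonical.eqOn_isLocalGRegular_H` ∕
`UnitaryGroup.isLocalDeltaTransferExists_iff_of_eqOn_gRegular_H` ∕ `UnitaryGroup.isLocalDeltaTransferExists_of_isCanonical_of_isCanonical` (§3, CM carriers at a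
finite place), `isLocalDeltaTransferExists_finExplicit_of_isCanonical` (§4, the head: N6 ∃-form ⇒ N6 for every canonical pair).
HC_CM is proved only modulo the printed citations until rung 0 closes; this file proves no printed citation (count-neutral plumbing).
References: J. D. Rogawski, *Automorphic Representations of Unitary Groups in Three Variables*, Ann. of Math. Stud. 123 (1990), §4.3 (4.3.1) p. 43, §4.9
Prop. 4.9.1 (a) p. 55, §1.7 p. 6 [Rogawski1990]; A. Deitmar, S. Echterhoff, *Principles of Harmonic Analysis*, 2nd ed. (2014), Thm. 1.5.3 (quotient measure)
[DeitmarEchterhoff2014].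
-/

set_option autoImplicit false

noncomputable section

open MeasureTheory Measure Set Topology NumberField IsDedekindDomain
open scoped ENNReal NNReal Matrix MatrixGroups

namespace Literature.NumberTheory.Automorphic

/-! ## §1 Abstract: two canonical families for the same `(P, ν)` agree at every `P`-class -/

section CanonUniq

variable {G : Type*} [Group G] [TopologicalSpace G] [IsTopologicalGroup G] [LocallyCompactSpace G] [SecondCountableTopology G] [T2Space G]
  [MeasurableSpace G] [BorelSpace G] [∀ γ : G, MeasurableSpace (G ⧸ Subgroup.centralizer ({γ} : Set G))]
  [∀ γ : G, BorelSpace (G ⧸ Subgroup.centralizer ({γ} : Set G))]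

/-- **CANONICAL FAMILIES ARE UNIQUE ON THE `P`-CLASSES.**  If `m` and `m′` are both canonical for `(P, ν)` then `m′ c = m c` at every `P`-class `c`: both are
`dν ∕ dt` for a Haar measure `t` on the centraliser `Z(γ_c)` with `t(core) = 1`; two Haar measures on the second countable locally compact group `Z(γ_c)` are
proportional (Mathlib `isMulLeftInvariant_eq_smul`) and the factor is `t′(core) ∕ t(core) = 1 ∕ 1`.
[cite: Rogawski1990, §4.3 (4.3.1) p. 43; §1.7 p. 6] [cite: DeitmarEchterhoff2014, Thm. 1.5.3] -/
theorem OrbitalMeasureFamily.IsCanonical.eqOn {P : G → Prop} {ν : Measure G}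
    [IsFiniteMeasureOnCompacts ν] [ν.IsMulRightInvariant] {m m' : OrbitalMeasureFamily G}
    (hm : m.IsCanonical P ν) (hm' : m'.IsCanonical P ν) (c : ConjClasses G) (hc : P (Quotient.out c)) : m' c = m c := by
  obtain ⟨t, ht, hti, ht1, hmc⟩ := hm c hc
  obtain ⟨t', ht', hti', ht'1, hm'c⟩ := hm' c hc
  haveI : LocallyCompactSpace (Subgroup.centralizer ({(Quotient.out c : G)} : Set G)) :=
    (isClosed_coe_centralizer_singleton (Quotient.out c)).isClosedEmbedding_subtypeVal.locallyCompactSpace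
  have hs : t' = haarScalarFactor t' t • t := isMulLeftInvariant_eq_smul t' t
  have h1 : haarScalarFactor t' t = 1 := by
    have h := congrArg (fun μ : Measure (Subgroup.centralizer ({(Quotient.out c : G)} : Set G)) =>
      μ (compactCore (Subgroup.centralizer ({(Quotient.out c : G)} : Set G)))) hs
    simp only [Measure.coe_nnreal_smul_apply, ht1, ht'1, mul_one] at h
    exact_mod_cast h.symm
  have htt : t' = t := by rw [hs, h1, one_smul]
  subst htt
  rw [hm'c, hmc]

end CanonUniq

/-! ## §2 Abstract: (4.3.1) reads the `H`-family only at the classes stably conjugate to a `G`-regular `γ_H` -/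

section Relations

variable {A B : Type*} [Group A] [Group B]
  [∀ a : A, MeasurableSpace (A ⧸ Subgroup.centralizer ({a} : Set A))]
  [∀ b : B, MeasurableSpace (B ⧸ Subgroup.centralizer ({b} : Set B))]

open Literature.NumberTheory.Rogawski1990 in
/-- **(4.3.1) is PATCH-SAFE in the `H`-family**: `Φ^{st}(γ_H, f^H)` reads `m_H c` only where `st γ_H (out c)`, so agreement at the classes stably conjugate
to a `regA` element suffices. [cite: Rogawski1990, §4.3 (4.3.1) p. 43; §4.1 (4.1.1) p. 39] -/
theorem IsDeltaTransferRel.iff_of_eqOn_left {R : A → B → Prop} {stA : A → A → Prop} {regA : A → Prop} (T : TransferFactorData A B R)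
    {mH mH₂ : OrbitalMeasureFamily A} (mG : OrbitalMeasureFamily B)
    (h : ∀ a : A, regA a → ∀ c : ConjClasses A, stA a (Quotient.out c) → mH₂ c = mH c) (fH : A → ℂ) (f : B → ℂ) :
    IsDeltaTransferRel R stA regA T mH mG fH f ↔ IsDeltaTransferRel R stA regA T mH₂ mG fH f := by
  refine forall_congr' fun a => forall_congr' fun ha => ?_
  rw [stableOrbitalIntegralRel_congr_of_eqOn (h a ha) fH]

open Literature.NumberTheory.Rogawski1990 in
/-- **The ∃-form of (4.3.1) ∕ Prop. 4.9.1 (a) is patch-safe in the `H`-family** (same hypothesis). [cite: Rogawski1990, §4.9 Prop. 4.9.1 (a) p. 55] -/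
theorem IsDeltaTransferExistsRel.iff_of_eqOn_left {R : A → B → Prop} {stA : A → A → Prop} {regA : A → Prop} (T : TransferFactorData A B R)
    {mH mH₂ : OrbitalMeasureFamily A} (mG : OrbitalMeasureFamily B)
    (h : ∀ a : A, regA a → ∀ c : ConjClasses A, stA a (Quotient.out c) → mH₂ c = mH c)
    (SmoothG : (B → ℂ) → Prop) (SmoothH : (A → ℂ) → Prop) :
    IsDeltaTransferExistsRel R stA regA T mH mG SmoothG SmoothH ↔ IsDeltaTransferExistsRel R stA regA T mH₂ mG SmoothG SmoothH :=
  forall_congr' fun f => forall_congr' fun _ => exists_congr fun fH => and_congr Iff.rfl (IsDeltaTransferRel.iff_of_eqOn_left T mG h fH f)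

end Relations

end Literature.NumberTheory.Automorphic

/-! ## §3 The CM carriers at a finite place `v`: canonical pairs agree on the (`G`-)regular classes; transfer transports -/

namespace Literature.NumberTheory.Automorphic.UnitaryGroup

open Literature.NumberTheory.Rogawski1990

variable (L : Type) [Field L] [NumberField L] [IsCMField L] (H' : Matrix (Fin 3) (Fin 3) L) (v : HeightOneSpectrum (𝓞 ↥(maximalRealSubfield L)))

section GSide

variable
  [MeasurableSpace ((cmDatum L 3 H').Local v)] [BorelSpace ((cmDatum L 3 H').Local v)]
  [∀ γ : (cmDatum L 3 H').Local v, MeasurableSpace ((cmDatum L 3 H').Local v ⧸ Subgroup.centralizer ({γ} : Set ((cmDatum L 3 H').Local v)))]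
  [∀ γ : (cmDatum L 3 H').Local v, BorelSpace ((cmDatum L 3 H').Local v ⧸ Subgroup.centralizer ({γ} : Set ((cmDatum L 3 H').Local v)))]

/-- **Two canonical `G′`-families agree on the regular classes** of `U(H′)(L⁺_v)` (★ `IsCanonical.eqOn` on the CM carrier). [cite: Rogawski1990, §4.3 (4.3.1) p. 43; §1.7 p. 6] -/
theorem IsCanonical.eqOn_isRegularElt_G
    (νG : Measure ((cmDatum L 3 H').Local v)) [νG.IsHaarMeasure] [νG.IsMulRightInvariant]
    {mG mG' : OrbitalMeasureFamily ((cmDatum L 3 H').Local v)}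
    (h : mG.IsCanonical (fun γ => IsRegularElt (γ.val : GL (Fin 3) (LocalRing L v))) νG)
    (h' : mG'.IsCanonical (fun γ => IsRegularElt (γ.val : GL (Fin 3) (LocalRing L v))) νG) :
    ∀ c : ConjClasses ((cmDatum L 3 H').Local v), IsRegularElt ((Quotient.out c).val : GL (Fin 3) (LocalRing L v)) → mG' c = mG c := fun c hc =>
  h.eqOn h' c hc

end GSide

section HSide

variable
  [MeasurableSpace ((cmDatum L 2 (Matrix.of fun i j : Fin 2 => if i.val + j.val + 1 = 2 then (1 : L) else 0)).Local v ×
    (cmDatum L 1 (Matrix.of fun i j : Fin 1 => if i.val + j.val + 1 = 1 then (1 : L) else 0)).Local v)]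
  [BorelSpace ((cmDatum L 2 (Matrix.of fun i j : Fin 2 => if i.val + j.val + 1 = 2 then (1 : L) else 0)).Local v ×
    (cmDatum L 1 (Matrix.of fun i j : Fin 1 => if i.val + j.val + 1 = 1 then (1 : L) else 0)).Local v)]
  [∀ a : ((cmDatum L 2 (Matrix.of fun i j : Fin 2 => if i.val + j.val + 1 = 2 then (1 : L) else 0)).Local v ×
      (cmDatum L 1 (Matrix.of fun i j : Fin 1 => if i.val + j.val + 1 = 1 then (1 : L) else 0)).Local v),
    MeasurableSpace (((cmDatum L 2 (Matrix.of fun i j : Fin 2 => if i.val + j.val + 1 = 2 then (1 : L) else 0)).Local v ×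
      (cmDatum L 1 (Matrix.of fun i j : Fin 1 => if i.val + j.val + 1 = 1 then (1 : L) else 0)).Local v) ⧸
      Subgroup.centralizer ({a} : Set ((cmDatum L 2 (Matrix.of fun i j : Fin 2 => if i.val + j.val + 1 = 2 then (1 : L) else 0)).Local v ×
      (cmDatum L 1 (Matrix.of fun i j : Fin 1 => if i.val + j.val + 1 = 1 then (1 : L) else 0)).Local v)))]
  [∀ a : ((cmDatum L 2 (Matrix.of fun i j : Fin 2 => if i.val + j.val + 1 = 2 then (1 : L) else 0)).Local v ×
      (cmDatum L 1 (Matrix.of fun i j : Fin 1 => if i.val + j.val + 1 = 1 then (1 : L) else 0)).Local v),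
    BorelSpace (((cmDatum L 2 (Matrix.of fun i j : Fin 2 => if i.val + j.val + 1 = 2 then (1 : L) else 0)).Local v ×
      (cmDatum L 1 (Matrix.of fun i j : Fin 1 => if i.val + j.val + 1 = 1 then (1 : L) else 0)).Local v) ⧸
      Subgroup.centralizer ({a} : Set ((cmDatum L 2 (Matrix.of fun i j : Fin 2 => if i.val + j.val + 1 = 2 then (1 : L) else 0)).Local v ×
      (cmDatum L 1 (Matrix.of fun i j : Fin 1 => if i.val + j.val + 1 = 1 then (1 : L) else 0)).Local v)))]

/-- **Two canonical `H`-families agree on the `G`-regular classes** of `H_v = U(Φ₂)(L⁺_v) × U(Φ₁)(L⁺_v)` (★ `IsCanonical.eqOn` on the CM carrier).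
[cite: Rogawski1990, §4.3 (4.3.1) p. 43; §1.7 p. 6] -/
theorem IsCanonical.eqOn_isLocalGRegular_H
    (νH : Measure ((cmDatum L 2 (Matrix.of fun i j : Fin 2 => if i.val + j.val + 1 = 2 then (1 : L) else 0)).Local v ×
      (cmDatum L 1 (Matrix.of fun i j : Fin 1 => if i.val + j.val + 1 = 1 then (1 : L) else 0)).Local v)) [νH.IsHaarMeasure] [νH.IsMulRightInvariant]
    {mH mH' : OrbitalMeasureFamily ((cmDatum L 2 (Matrix.of fun i j : Fin 2 => if i.val + j.val + 1 = 2 then (1 : L) else 0)).Local v ×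
      (cmDatum L 1 (Matrix.of fun i j : Fin 1 => if i.val + j.val + 1 = 1 then (1 : L) else 0)).Local v)}
    (h : mH.IsCanonical (IsLocalGRegular L v) νH) (h' : mH'.IsCanonical (IsLocalGRegular L v) νH) :
    ∀ c : ConjClasses ((cmDatum L 2 (Matrix.of fun i j : Fin 2 => if i.val + j.val + 1 = 2 then (1 : L) else 0)).Local v ×
      (cmDatum L 1 (Matrix.of fun i j : Fin 1 => if i.val + j.val + 1 = 1 then (1 : L) else 0)).Local v),
      IsLocalGRegular L v (Quotient.out c) → mH' c = mH c := fun c hc =>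
  h.eqOn h' c hc

end HSide

section Quot

variable
  [∀ a : ((cmDatum L 2 (Matrix.of fun i j : Fin 2 => if i.val + j.val + 1 = 2 then (1 : L) else 0)).Local v ×
      (cmDatum L 1 (Matrix.of fun i j : Fin 1 => if i.val + j.val + 1 = 1 then (1 : L) else 0)).Local v),
    MeasurableSpace (((cmDatum L 2 (Matrix.of fun i j : Fin 2 => if i.val + j.val + 1 = 2 then (1 : L) else 0)).Local v ×
      (cmDatum L 1 (Matrix.of fun i j : Fin 1 => if i.val + j.val + 1 = 1 then (1 : L) else 0)).Local v) ⧸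
      Subgroup.centralizer ({a} : Set ((cmDatum L 2 (Matrix.of fun i j : Fin 2 => if i.val + j.val + 1 = 2 then (1 : L) else 0)).Local v ×
      (cmDatum L 1 (Matrix.of fun i j : Fin 1 => if i.val + j.val + 1 = 1 then (1 : L) else 0)).Local v)))]
  [∀ γ : (cmDatum L 3 H').Local v, MeasurableSpace ((cmDatum L 3 H').Local v ⧸ Subgroup.centralizer ({γ} : Set ((cmDatum L 3 H').Local v)))]

/-- **Prop. 4.9.1 (a) at `v` is patch-safe in the `H`-family**: agreement of `m_H₂`∕`m_H` on the `G`-regular classes suffices (the classes stably conjugate to a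
`G`-regular `γ_H` are `G`-regular, ★ `isLocalGRegular_of_isLocalStablyConjH`). [cite: Rogawski1990, §4.9 Prop. 4.9.1 (a) p. 55; §4.3 p. 42] -/
theorem isLocalDeltaTransferExists_iff_of_eqOn_gRegular_H (T : LocalTransferFactor L H' v)
    {mH mH₂ : OrbitalMeasureFamily ((cmDatum L 2 (Matrix.of fun i j : Fin 2 => if i.val + j.val + 1 = 2 then (1 : L) else 0)).Local v ×
      (cmDatum L 1 (Matrix.of fun i j : Fin 1 => if i.val + j.val + 1 = 1 then (1 : L) else 0)).Local v)}
    (mG : OrbitalMeasureFamily ((cmDatum L 3 H').Local v))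
    (h : ∀ c : ConjClasses ((cmDatum L 2 (Matrix.of fun i j : Fin 2 => if i.val + j.val + 1 = 2 then (1 : L) else 0)).Local v ×
      (cmDatum L 1 (Matrix.of fun i j : Fin 1 => if i.val + j.val + 1 = 1 then (1 : L) else 0)).Local v),
      IsLocalGRegular L v (Quotient.out c) → mH₂ c = mH c)
    (Smooth' : ((cmDatum L 3 H').Local v → ℂ) → Prop)
    (SmoothH : (((cmDatum L 2 (Matrix.of fun i j : Fin 2 => if i.val + j.val + 1 = 2 then (1 : L) else 0)).Local v ×
      (cmDatum L 1 (Matrix.of fun i j : Fin 1 => if i.val + j.val + 1 = 1 then (1 : L) else 0)).Local v) → ℂ) → Prop) :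
    IsLocalDeltaTransferExists L H' v T mH mG Smooth' SmoothH ↔ IsLocalDeltaTransferExists L H' v T mH₂ mG Smooth' SmoothH :=
  IsDeltaTransferExistsRel.iff_of_eqOn_left T mG
    (fun _ ha c hc => h c (isLocalGRegular_of_isLocalStablyConjH (L := L) (v := v) hc ha)) Smooth' SmoothH

end Quot

section Both

variable
  [MeasurableSpace ((cmDatum L 3 H').Local v)] [BorelSpace ((cmDatum L 3 H').Local v)]
  [MeasurableSpace ((cmDatum L 2 (Matrix.of fun i j : Fin 2 => if i.val + j.val + 1 = 2 then (1 : L) else 0)).Local v ×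
    (cmDatum L 1 (Matrix.of fun i j : Fin 1 => if i.val + j.val + 1 = 1 then (1 : L) else 0)).Local v)]
  [BorelSpace ((cmDatum L 2 (Matrix.of fun i j : Fin 2 => if i.val + j.val + 1 = 2 then (1 : L) else 0)).Local v ×
    (cmDatum L 1 (Matrix.of fun i j : Fin 1 => if i.val + j.val + 1 = 1 then (1 : L) else 0)).Local v)]
  [∀ a : ((cmDatum L 2 (Matrix.of fun i j : Fin 2 => if i.val + j.val + 1 = 2 then (1 : L) else 0)).Local v ×
      (cmDatum L 1 (Matrix.of fun i j : Fin 1 => if i.val + j.val + 1 = 1 then (1 : L) else 0)).Local v),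
    MeasurableSpace (((cmDatum L 2 (Matrix.of fun i j : Fin 2 => if i.val + j.val + 1 = 2 then (1 : L) else 0)).Local v ×
      (cmDatum L 1 (Matrix.of fun i j : Fin 1 => if i.val + j.val + 1 = 1 then (1 : L) else 0)).Local v) ⧸
      Subgroup.centralizer ({a} : Set ((cmDatum L 2 (Matrix.of fun i j : Fin 2 => if i.val + j.val + 1 = 2 then (1 : L) else 0)).Local v ×
      (cmDatum L 1 (Matrix.of fun i j : Fin 1 => if i.val + j.val + 1 = 1 then (1 : L) else 0)).Local v)))]
  [∀ a : ((cmDatum L 2 (Matrix.of fun i j : Fin 2 => if i.val + j.val + 1 = 2 then (1 : L) else 0)).Local v ×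
      (cmDatum L 1 (Matrix.of fun i j : Fin 1 => if i.val + j.val + 1 = 1 then (1 : L) else 0)).Local v),
    BorelSpace (((cmDatum L 2 (Matrix.of fun i j : Fin 2 => if i.val + j.val + 1 = 2 then (1 : L) else 0)).Local v ×
      (cmDatum L 1 (Matrix.of fun i j : Fin 1 => if i.val + j.val + 1 = 1 then (1 : L) else 0)).Local v) ⧸
      Subgroup.centralizer ({a} : Set ((cmDatum L 2 (Matrix.of fun i j : Fin 2 => if i.val + j.val + 1 = 2 then (1 : L) else 0)).Local v ×
      (cmDatum L 1 (Matrix.of fun i j : Fin 1 => if i.val + j.val + 1 = 1 then (1 : L) else 0)).Local v)))]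
  [∀ γ : (cmDatum L 3 H').Local v, MeasurableSpace ((cmDatum L 3 H').Local v ⧸ Subgroup.centralizer ({γ} : Set ((cmDatum L 3 H').Local v)))]
  [∀ γ : (cmDatum L 3 H').Local v, BorelSpace ((cmDatum L 3 H').Local v ⧸ Subgroup.centralizer ({γ} : Set ((cmDatum L 3 H').Local v)))]

/-- **LOCAL `Δ_v`-TRANSFER TRANSPORTS BETWEEN CANONICAL PAIRS**: if `(m_H, m_G)` and `(m_H₂, m_G₂)` are both canonical (for the same Haar measures `νH_v`, `νG_v`)
and every `φ` has a `Δ_v`-transfer for `(m_H, m_G)`, then every `φ` has one for `(m_H₂, m_G₂)` — same `φ^H`. [cite: Rogawski1990, §4.9 Prop. 4.9.1 (a) p. 55; §4.3 (4.3.1) p. 43] -/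
theorem isLocalDeltaTransferExists_of_isCanonical_of_isCanonical (T : LocalTransferFactor L H' v)
    (νH : Measure ((cmDatum L 2 (Matrix.of fun i j : Fin 2 => if i.val + j.val + 1 = 2 then (1 : L) else 0)).Local v ×
      (cmDatum L 1 (Matrix.of fun i j : Fin 1 => if i.val + j.val + 1 = 1 then (1 : L) else 0)).Local v)) [νH.IsHaarMeasure] [νH.IsMulRightInvariant]
    (νG : Measure ((cmDatum L 3 H').Local v)) [νG.IsHaarMeasure] [νG.IsMulRightInvariant]
    {mH mH₂ : OrbitalMeasureFamily ((cmDatum L 2 (Matrix.of fun i j : Fin 2 => if i.val + j.val + 1 = 2 then (1 : L) else 0)).Local v ×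
      (cmDatum L 1 (Matrix.of fun i j : Fin 1 => if i.val + j.val + 1 = 1 then (1 : L) else 0)).Local v)}
    {mG mG₂ : OrbitalMeasureFamily ((cmDatum L 3 H').Local v)}
    (hmH : mH.IsCanonical (IsLocalGRegular L v) νH) (hmG : mG.IsCanonical (fun γ => IsRegularElt (γ.val : GL (Fin 3) (LocalRing L v))) νG)
    (hmH₂ : mH₂.IsCanonical (IsLocalGRegular L v) νH) (hmG₂ : mG₂.IsCanonical (fun γ => IsRegularElt (γ.val : GL (Fin 3) (LocalRing L v))) νG)
    (Smooth' : ((cmDatum L 3 H').Local v → ℂ) → Prop)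
    (SmoothH : (((cmDatum L 2 (Matrix.of fun i j : Fin 2 => if i.val + j.val + 1 = 2 then (1 : L) else 0)).Local v ×
      (cmDatum L 1 (Matrix.of fun i j : Fin 1 => if i.val + j.val + 1 = 1 then (1 : L) else 0)).Local v) → ℂ) → Prop)
    (hex : IsLocalDeltaTransferExists L H' v T mH mG Smooth' SmoothH) :
    IsLocalDeltaTransferExists L H' v T mH₂ mG₂ Smooth' SmoothH :=
  (isLocalDeltaTransferExists_iff_of_eqOn_regular L H' v T mH₂
      (fun c hc => IsCanonical.eqOn_isRegularElt_G L H' v νG hmG hmG₂ c hc) Smooth' SmoothH).1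
    ((isLocalDeltaTransferExists_iff_of_eqOn_gRegular_H L H' v T mG
      (fun c hc => IsCanonical.eqOn_isLocalGRegular_H L v νH hmH hmH₂ c hc) Smooth' SmoothH).1 hex)

end Both

end Literature.NumberTheory.Automorphic.UnitaryGroup

/-! ## §4 The head: N6 (∃-form) gives local `Δ‴_v`-transfer for EVERY canonical pair -/

namespace Literature.NumberTheory.Rogawski1990

open Literature.NumberTheory.Automorphic Literature.NumberTheory.Automorphic.UnitaryGroup Literature.NumberTheory.GaloisRepresentations

/-- **[Rogawski1990 Prop. 4.9.1 (a)] FOR EVERY CANONICAL PAIR.**  At a frame where N6 holds in the tree's ∃-form (★ `LocalTransferExplicit L H′ μ νH νG`: at each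
finite `v` SOME canonical pair `(m_H, m_G)` has a `Δ‴_v`-transfer for every `φ ∈ C_c^∞`), EVERY canonical pair has one: the statement the closer's rider `Q_K9S` exposes as (G3) `hex₀` in edition «Δ‴-PINS EXPOSED», a one-liner in `Kit.rung0_of_letters`'
callback over this theorem.  Borel σ-algebras on the orbit quotients as in ★ `LocalTransferExplicit`. [cite: Rogawski1990, §4.9 Prop. 4.9.1 (a) p. 55; §4.3 (4.3.1) p. 43; §1.7 p. 6]
[cite: DeitmarEchterhoff2014, Thm. 1.5.3] -/
theorem isLocalDeltaTransferExists_finExplicit_of_isCanonical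
    (L : Type) [Field L] [NumberField L] [IsCMField L] (H' : Matrix (Fin 3) (Fin 3) L) (μ : HeckeCharacter L)
    [∀ v : HeightOneSpectrum (𝓞 ↥(maximalRealSubfield L)),
      MeasurableSpace ((UnitaryGroup.cmDatum L 2 (Matrix.of fun i j : Fin 2 => if i.val + j.val + 1 = 2 then (1 : L) else 0)).Local v ×
        (UnitaryGroup.cmDatum L 1 (Matrix.of fun i j : Fin 1 => if i.val + j.val + 1 = 1 then (1 : L) else 0)).Local v)]
    [∀ v : HeightOneSpectrum (𝓞 ↥(maximalRealSubfield L)),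
      BorelSpace ((UnitaryGroup.cmDatum L 2 (Matrix.of fun i j : Fin 2 => if i.val + j.val + 1 = 2 then (1 : L) else 0)).Local v ×
        (UnitaryGroup.cmDatum L 1 (Matrix.of fun i j : Fin 1 => if i.val + j.val + 1 = 1 then (1 : L) else 0)).Local v)]
    [∀ v : HeightOneSpectrum (𝓞 ↥(maximalRealSubfield L)), MeasurableSpace ((UnitaryGroup.cmDatum L 3 H').Local v)]
    [∀ v : HeightOneSpectrum (𝓞 ↥(maximalRealSubfield L)), BorelSpace ((UnitaryGroup.cmDatum L 3 H').Local v)]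
    (νH : ∀ v : HeightOneSpectrum (𝓞 ↥(maximalRealSubfield L)),
      Measure ((UnitaryGroup.cmDatum L 2 (Matrix.of fun i j : Fin 2 => if i.val + j.val + 1 = 2 then (1 : L) else 0)).Local v ×
        (UnitaryGroup.cmDatum L 1 (Matrix.of fun i j : Fin 1 => if i.val + j.val + 1 = 1 then (1 : L) else 0)).Local v))
    (νG : ∀ v : HeightOneSpectrum (𝓞 ↥(maximalRealSubfield L)), Measure ((UnitaryGroup.cmDatum L 3 H').Local v))
    [∀ v, (νH v).IsHaarMeasure] [∀ v, (νH v).IsMulRightInvariant] [∀ v, (νG v).IsHaarMeasure] [∀ v, (νG v).IsMulRightInvariant]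
    (hN6 : LocalTransferExplicit L H' μ νH νG) (v : HeightOneSpectrum (𝓞 ↥(maximalRealSubfield L))) :
    letI : ∀ (v : HeightOneSpectrum (𝓞 ↥(maximalRealSubfield L)))
        (a : ((UnitaryGroup.cmDatum L 2 (Matrix.of fun i j : Fin 2 => if i.val + j.val + 1 = 2 then (1 : L) else 0)).Local v ×
          (UnitaryGroup.cmDatum L 1 (Matrix.of fun i j : Fin 1 => if i.val + j.val + 1 = 1 then (1 : L) else 0)).Local v)),
        MeasurableSpace (((UnitaryGroup.cmDatum L 2 (Matrix.of fun i j : Fin 2 => if i.val + j.val + 1 = 2 then (1 : L) else 0)).Local v ×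
          (UnitaryGroup.cmDatum L 1 (Matrix.of fun i j : Fin 1 => if i.val + j.val + 1 = 1 then (1 : L) else 0)).Local v) ⧸
          Subgroup.centralizer ({a} : Set ((UnitaryGroup.cmDatum L 2 (Matrix.of fun i j : Fin 2 => if i.val + j.val + 1 = 2 then (1 : L) else 0)).Local v ×
          (UnitaryGroup.cmDatum L 1 (Matrix.of fun i j : Fin 1 => if i.val + j.val + 1 = 1 then (1 : L) else 0)).Local v))) :=
      fun _ _ => borel _
    haveI : ∀ (v : HeightOneSpectrum (𝓞 ↥(maximalRealSubfield L)))
        (a : ((UnitaryGroup.cmDatum L 2 (Matrix.of fun i j : Fin 2 => if i.val + j.val + 1 = 2 then (1 : L) else 0)).Local v ×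
          (UnitaryGroup.cmDatum L 1 (Matrix.of fun i j : Fin 1 => if i.val + j.val + 1 = 1 then (1 : L) else 0)).Local v)),
        BorelSpace (((UnitaryGroup.cmDatum L 2 (Matrix.of fun i j : Fin 2 => if i.val + j.val + 1 = 2 then (1 : L) else 0)).Local v ×
          (UnitaryGroup.cmDatum L 1 (Matrix.of fun i j : Fin 1 => if i.val + j.val + 1 = 1 then (1 : L) else 0)).Local v) ⧸
          Subgroup.centralizer ({a} : Set ((UnitaryGroup.cmDatum L 2 (Matrix.of fun i j : Fin 2 => if i.val + j.val + 1 = 2 then (1 : L) else 0)).Local v ×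
          (UnitaryGroup.cmDatum L 1 (Matrix.of fun i j : Fin 1 => if i.val + j.val + 1 = 1 then (1 : L) else 0)).Local v))) :=
      fun _ _ => ⟨rfl⟩
    letI : ∀ (v : HeightOneSpectrum (𝓞 ↥(maximalRealSubfield L))) (γ : (UnitaryGroup.cmDatum L 3 H').Local v),
        MeasurableSpace ((UnitaryGroup.cmDatum L 3 H').Local v ⧸ Subgroup.centralizer ({γ} : Set ((UnitaryGroup.cmDatum L 3 H').Local v))) :=
      fun _ _ => borel _
    haveI : ∀ (v : HeightOneSpectrum (𝓞 ↥(maximalRealSubfield L))) (γ : (UnitaryGroup.cmDatum L 3 H').Local v),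
        BorelSpace ((UnitaryGroup.cmDatum L 3 H').Local v ⧸ Subgroup.centralizer ({γ} : Set ((UnitaryGroup.cmDatum L 3 H').Local v))) :=
      fun _ _ => ⟨rfl⟩
    ∀ (mH : OrbitalMeasureFamily ((UnitaryGroup.cmDatum L 2 (Matrix.of fun i j : Fin 2 => if i.val + j.val + 1 = 2 then (1 : L) else 0)).Local v ×
        (UnitaryGroup.cmDatum L 1 (Matrix.of fun i j : Fin 1 => if i.val + j.val + 1 = 1 then (1 : L) else 0)).Local v))
      (mG : OrbitalMeasureFamily ((UnitaryGroup.cmDatum L 3 H').Local v)),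
      mH.IsCanonical (IsLocalGRegular L v) (νH v) →
        mG.IsCanonical (fun γ => IsRegularElt (γ.val : GL (Fin 3) (UnitaryGroup.LocalRing L v))) (νG v) →
          IsLocalDeltaTransferExists L H' v ((finExplicitCollection L H' μ (finExplicitDelta_conj_left_all L H' μ) (finExplicitDelta_conj_right_all L H' μ)) v)
            mH mG IsLocSmooth IsLocSmooth := by
  letI : ∀ (v : HeightOneSpectrum (𝓞 ↥(maximalRealSubfield L)))
      (a : ((UnitaryGroup.cmDatum L 2 (Matrix.of fun i j : Fin 2 => if i.val + j.val + 1 = 2 then (1 : L) else 0)).Local v ×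
        (UnitaryGroup.cmDatum L 1 (Matrix.of fun i j : Fin 1 => if i.val + j.val + 1 = 1 then (1 : L) else 0)).Local v)),
      MeasurableSpace (((UnitaryGroup.cmDatum L 2 (Matrix.of fun i j : Fin 2 => if i.val + j.val + 1 = 2 then (1 : L) else 0)).Local v ×
        (UnitaryGroup.cmDatum L 1 (Matrix.of fun i j : Fin 1 => if i.val + j.val + 1 = 1 then (1 : L) else 0)).Local v) ⧸
        Subgroup.centralizer ({a} : Set ((UnitaryGroup.cmDatum L 2 (Matrix.of fun i j : Fin 2 => if i.val + j.val + 1 = 2 then (1 : L) else 0)).Local v ×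
        (UnitaryGroup.cmDatum L 1 (Matrix.of fun i j : Fin 1 => if i.val + j.val + 1 = 1 then (1 : L) else 0)).Local v))) :=
    fun _ _ => borel _
  haveI : ∀ (v : HeightOneSpectrum (𝓞 ↥(maximalRealSubfield L)))
      (a : ((UnitaryGroup.cmDatum L 2 (Matrix.of fun i j : Fin 2 => if i.val + j.val + 1 = 2 then (1 : L) else 0)).Local v ×
        (UnitaryGroup.cmDatum L 1 (Matrix.of fun i j : Fin 1 => if i.val + j.val + 1 = 1 then (1 : L) else 0)).Local v)),
      BorelSpace (((UnitaryGroup.cmDatum L 2 (Matrix.of fun i j : Fin 2 => if i.val + j.val + 1 = 2 then (1 : L) else 0)).Local v ×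
        (UnitaryGroup.cmDatum L 1 (Matrix.of fun i j : Fin 1 => if i.val + j.val + 1 = 1 then (1 : L) else 0)).Local v) ⧸
        Subgroup.centralizer ({a} : Set ((UnitaryGroup.cmDatum L 2 (Matrix.of fun i j : Fin 2 => if i.val + j.val + 1 = 2 then (1 : L) else 0)).Local v ×
        (UnitaryGroup.cmDatum L 1 (Matrix.of fun i j : Fin 1 => if i.val + j.val + 1 = 1 then (1 : L) else 0)).Local v))) :=
    fun _ _ => ⟨rfl⟩
  letI : ∀ (v : HeightOneSpectrum (𝓞 ↥(maximalRealSubfield L))) (γ : (UnitaryGroup.cmDatum L 3 H').Local v),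
      MeasurableSpace ((UnitaryGroup.cmDatum L 3 H').Local v ⧸ Subgroup.centralizer ({γ} : Set ((UnitaryGroup.cmDatum L 3 H').Local v))) :=
    fun _ _ => borel _
  haveI : ∀ (v : HeightOneSpectrum (𝓞 ↥(maximalRealSubfield L))) (γ : (UnitaryGroup.cmDatum L 3 H').Local v),
      BorelSpace ((UnitaryGroup.cmDatum L 3 H').Local v ⧸ Subgroup.centralizer ({γ} : Set ((UnitaryGroup.cmDatum L 3 H').Local v))) :=
    fun _ _ => ⟨rfl⟩
  intro mH mG hmH hmG
  obtain ⟨mH₆, mG₆, ⟨h₆H, h₆G⟩, hex₆⟩ := hN6 v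
  exact isLocalDeltaTransferExists_of_isCanonical_of_isCanonical L H' v _ (νH v) (νG v) h₆H h₆G hmH hmG IsLocSmooth IsLocSmooth hex₆

end Literature.NumberTheory.Rogawski1990

end
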